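import Mathlib.MeasureTheory.Integral.Bochner.Basic
import Mathlib.MeasureTheory.Measure.WithDensity
import Mathlib.MeasureTheory.Measure.Lebesgue.Basic
import Mathlib.MeasureTheory.Measure.Dirac
import Mathlib.MeasureTheory.Function.LocallyIntegrable
import Mathlib.Analysis.SpecialFunctions.Exp
import Literature.MathematicalPhysics.KineticTheory.FouriersLaw
import HarnessLib

/-!
# The lattice (labelled) Vlasov equation of a Kac-range oscillator chain

Topic `Literature/MathematicalPhysics/KineticTheory` (definition item `defn-LatticeVlasovEquation`, for
route `AtomisticToContinuum/KacRangeDichotomy`: informal cruxes LatticeVlasovLimit,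
TwoChannelKineticLimit, KacConductivityScaling). Sibling of `KacOscillatorChain.lean` (the `N`-body
model whose `R → ∞` continuum limit at fixed macroscopic length `L = N/R` this equation describes).

## The equation (Bachelard–Dauxois–De Ninno–Ruffo–Staniscia 2011, §II; Campa et al. 2014, Ch. 8)

Sites `x = 0, …, N-1` of a Kac chain of range `R` carry the frozen label `u = x/R ∈ [0, L]`; in the
continuum limit each label element `du` contains `R du → ∞` oscillators, described by a one-body
distribution `f(u, q, p, t)` ("a local distribution function in phase-space `f(q,p;x,t)`,
depending also on the spatial coordinate `x` along the lattice"). The self-consistent (mean-field)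
potential felt at label `u` is
`W_f(u, q) = ∫ φ(u - u′) V(q - q′) f(u′, q′, p′) du′ dq′ dp′`
(BDDNRS eq. for `V_x[f]`; Campa et al. (8.15)), and `f` obeys the **lattice Vlasov equation**
`∂_t f + p ∂_q f - ∂_q[U(q) + W_f(u, q)] ∂_p f = 0`
(BDDNRS eq. (Vl): "a continuum of Vlasov equations along the lattice, globally coupled through
the potential … the absence of a spatial derivative `∂_x` reminds us that the lattice sites are
fixed"; Campa et al. (8.18) is the label-free case `φ ≡ 1`), with the normalisation
`∬ f(u, q, p, t) dq dp = 1` for every label `u` (BDDNRS: homogeneous lattice, "the norm of `f` has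
to be the same at any position"), i.e. the `u`-marginal of `f_t` is Lebesgue measure on `[0, L]`.
Here `U` is the pinning potential of the chain (absent in BDDNRS, whose sites carry free rotors;
it enters the one-body Hamiltonian exactly like the mean field).

## Contents

* `LatticeVlasovEquation` — the data `(U, V, φ, L)`; for a Kac chain `K : KacOscillatorChain`
  (`KacOscillatorChain.lean`, not imported here) at macroscopic length `L` it is `⟨K.U, K.V, K.φ, L⟩`.
* One-body calculus on `ℝ × ℝ × ℝ ∋ z = (u, q, p)`: `partialQ`, `partialP`, the frozen-label
  canonical bracket `bracket f g = ∂_p f ∂_q g - ∂_q f ∂_p g` (sign convention of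
  `HeatConduction.poisson`, so that `bracket h ·` is the Liouville operator of `h`).
* `meanField E μ u q = W_μ(u,q)`, `energy E μ z = h_μ(u,q,p) = p²/2 + U(q) + W_μ(u,q)` (BDDNRS
  eq. for `h_x`), `force E μ u q = -∂_q (U + W_μ(u,·))(q)`, and the transport operator on
  observables `transport E μ g = p ∂_q g + force · ∂_p g = bracket h_μ g` (`transport_eq_bracket`).
* `IsAdmissible` (label marginal `=` Lebesgue on `[0,L]`, interaction integrable),
  **`IsWeakSolutionOn s f`** — measure-valued weak solutions on a time set `s`:
  `d/dt ∫ g df_t = ∫ (p ∂_q g - ∂_q[U + W_{f_t}] ∂_p g) df_t` for all `g ∈ C_c^∞(ℝ³)`, `t ∈ s`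
  (derivative within `s`, so `s = univ`, `Ici 0`, `Icc 0 T` all make sense);
  `IsStationary μ` (`∫ transport μ g dμ = 0`), `isStationary_iff_isWeakSolutionOn_univ`.
* `IsEnergyFunctionState F μ` — `dμ = F(u, h_μ) du dq dp` (self-consistent functions of the
  one-body energy; lemma target: all regular ones are stationary), and its thermal member,
  the thermal (Hartree, self-consistent Maxwell–Boltzmann) state at temperature `T`:
  `IsThermalState T μ` — `μ` has Lebesgue density `1_{[0,L]}(u) e^{-h_μ(u,q,p)/T} / Z_μ(u)`, the
  `F(e) = e^{-e/T}` member of the family of self-consistent functions of the one-body energy,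
  all of which are stationary (Campa et al. §9.1: "any distribution of the form `f₀ = F(e)` … is
  a stationary solution of the Vlasov equation, provided [the mean field is] determined
  self-consistently"); for `V(r) = r²/2` the self-consistency is the scalar (per label) equation
  for `m(u) = ∫ φ(u-u′) q′ dμ`.
* The linearised equation around a stationary `μ₀` for a perturbation density `g_t(u,q,p)`
  (w.r.t. `du dq dp`): `∂_t g = -bracket h_{μ₀} g… ` in weak form,
  `d/dt ∫ ψ g_t = ∫ (transport μ₀ ψ) g_t dz + ∫ (-∂_q W_{g_t}) ∂_p ψ dμ₀`, i.e.
  `∂_t g + p ∂_q g - ∂_q(U + W_{μ₀}) ∂_p g - ∂_q W_g ∂_p f₀ = 0` (Campa et al. (8.20), BDDNRS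
  eq. (17), there around homogeneous `f₀(p)`): `IsLinearisedSolutionOn s μ₀ g`.
* Calibration with the chain: `empiricalMeasure R x = R⁻¹ Σ_i δ_{(i/R, q_i, p_i)}` and
  `meanField_empiricalMeasure`: its mean field is the Kac pair sum `R⁻¹ Σ_j φ(u - j/R) V(q - q_j)`
  of `KacOscillatorChain.hamiltonian` (Klimontovich picture, Campa et al. §8.1).

## Design choices / what is NOT here

* States are finite Borel measures on `ℝ × ℝ × ℝ` (label, position, momentum) rather than
  densities, so that empirical measures of the chain live in the same space (mean-field limit
  statements à la Neunzert / Braun–Hepp / Dobrushin / Spohn compare `R⁻¹ Σ δ` with `f_t` weakly);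
  the label constraint `u ∈ [0, L]` is carried by the marginal condition, not by a subtype.
* The force is `-deriv (U + W_μ(u,·))`, a one-variable `deriv` (junk `0` where the slice is not
  differentiable, as everywhere in this topic); weak formulations ask the tested integrands to be
  integrable explicitly (no Bochner-junk stationarity).
* Perturbations in the linearised equation are signed densities `g_t : ℝ³ → ℝ` w.r.t. Lebesgue
  measure (Mathlib has no usable signed-measure integral); `μ₀` stays a measure.
* NOT here: existence/uniqueness/stability of weak solutions (Dobrushin 1979; non-exchangeable
  mean-field limits, Jabin–Poyato–Soler arXiv:2112.15406), the proof that `F(u, h_μ)`-states (in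
  particular thermal states) are stationary (an integration by parts in `(q, p)`; lemma target of
  the route), dispersion relations / Landau damping, baths (the Vlasov level is Hamiltonian).
-/

noncomputable section

open MeasureTheory Set Filter
open scoped ContDiff Topology ENNReal

namespace Literature.MathematicalPhysics.KineticTheory

/-- The data of a **lattice Vlasov equation**: pinning potential `U`, pair potential `V`, label
(Kac) kernel `φ` and macroscopic length `L` (labels `u ∈ [0, L]`); the continuum (`R → ∞`,
`N = LR`) description of the Kac-range oscillator chain `KacOscillatorChain`.
[cite: BachelardEtAl2011, §II (Vlasov equation on a lattice)] -/
structure LatticeVlasovEquation where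
  /-- the pinning (on-site) potential `U` -/
  U : ℝ → ℝ
  /-- the pair interaction potential `V` -/
  V : ℝ → ℝ
  /-- the label (Kac range) kernel `φ` -/
  φ : ℝ → ℝ
  /-- the macroscopic length: labels live in `[0, L]` -/
  L : ℝ

namespace LatticeVlasovEquation

/-! ### One-body calculus on `ℝ × ℝ × ℝ ∋ z = (u, q, p)` = (label, position, momentum) -/

/-- `∂_q g (u, q, p)`: derivative of the position slice. [folklore] -/
def partialQ (g : ℝ × ℝ × ℝ → ℝ) (z : ℝ × ℝ × ℝ) : ℝ :=
  deriv (fun x => g (z.1, x, z.2.2)) z.2.1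

/-- `∂_p g (u, q, p)`: derivative of the momentum slice. [folklore] -/
def partialP (g : ℝ × ℝ × ℝ → ℝ) (z : ℝ × ℝ × ℝ) : ℝ :=
  deriv (fun x => g (z.1, z.2.1, x)) z.2.2

/-- The canonical bracket in `(q, p)` at frozen label `u`:
`bracket f g = ∂_p f ∂_q g - ∂_q f ∂_p g` (convention of `HeatConduction.poisson`: `bracket h ·` is
the Liouville operator `p ∂_q - h_q ∂_p` of `h = p²/2 + …`). [folklore] -/
def bracket (f g : ℝ × ℝ × ℝ → ℝ) (z : ℝ × ℝ × ℝ) : ℝ :=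
  partialP f z * partialQ g z - partialQ f z * partialP g z

variable (E : LatticeVlasovEquation)

/-- The label measure: Lebesgue measure on `[0, L]` (one unit of label per `R` sites).
[cite: BachelardEtAl2011, §II (normalisation of f, homogeneous lattice)] -/
def labelMeasure : Measure ℝ := volume.restrict (Icc 0 E.L)

/-- The self-consistent mean-field potential at label `u`:
`W_μ(u, q) = ∫ φ(u - u′) V(q - q′) dμ(u′, q′, p′)`.
[cite: BachelardEtAl2011, §II (the long-range potential V_x[f])] -/
def meanField (μ : Measure (ℝ × ℝ × ℝ)) (u q : ℝ) : ℝ :=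
  ∫ z, E.φ (u - z.1) * E.V (q - z.2.1) ∂μ

/-- The self-consistent one-body energy `h_μ(u, q, p) = p²/2 + U(q) + W_μ(u, q)`.
[cite: BachelardEtAl2011, §III (the test-particle Hamiltonian h_x)] -/
def energy (μ : Measure (ℝ × ℝ × ℝ)) (z : ℝ × ℝ × ℝ) : ℝ :=
  z.2.2 ^ 2 / 2 + E.U z.2.1 + E.meanField μ z.1 z.2.1

/-- The self-consistent force `-∂_q [U(q) + W_μ(u, q)]` at label `u` (junk `0` where the slice is not
differentiable). [cite: BachelardEtAl2011, §II (continuum equations of motion)] -/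
def force (μ : Measure (ℝ × ℝ × ℝ)) (u q : ℝ) : ℝ :=
  -deriv (fun x => E.U x + E.meanField μ u x) q

/-- The transport (one-body Liouville) operator in the self-consistent field of `μ`, applied to an
observable `g`: `X_μ g = p ∂_q g - ∂_q[U + W_μ] ∂_p g` (the vector field of the characteristics
`q̇ = p`, `ṗ = -∂_q(U + W_μ)`; labels do not move). [cite: BachelardEtAl2011, §II (eq. (Vl))] -/
def transport (μ : Measure (ℝ × ℝ × ℝ)) (g : ℝ × ℝ × ℝ → ℝ) (z : ℝ × ℝ × ℝ) : ℝ :=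
  z.2.2 * partialQ g z + E.force μ z.1 z.2.1 * partialP g z

/-! ### States, weak solutions, stationary states -/

/-- Admissible one-body states: the label marginal is Lebesgue measure on `[0, L]` ("each
infinitesimal element `dx` contains the same number of particles": `∬ f dq dp = 1` at every label)
and the pair interaction is `μ`-integrable, so that `W_μ` is an honest integral.
[cite: BachelardEtAl2011, §II (normalisation of f)] -/
structure IsAdmissible (μ : Measure (ℝ × ℝ × ℝ)) : Prop where
  map_fst : μ.map Prod.fst = E.labelMeasure
  integrable : ∀ u q : ℝ, Integrable (fun z : ℝ × ℝ × ℝ => E.φ (u - z.1) * E.V (q - z.2.1)) μ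

/-- **Weak (measure-valued) solutions of the lattice Vlasov equation on a time set `s`**: a curve
`t ↦ f_t` of admissible states such that for every smooth compactly supported observable `g` and
every `t ∈ s`, `X_{f_t} g` is `f_t`-integrable and
`d/dt ∫ g df_t = ∫ (p ∂_q g - ∂_q[U + W_{f_t}](u,q) ∂_p g) df_t` (derivative within `s`). For a
density `f_t du dq dp` this is `∂_t f + p ∂_q f - ∂_q[U + W_f] ∂_p f = 0` integrated against `g`.
[cite: BachelardEtAl2011, §II (eq. (Vl))] -/
structure IsWeakSolutionOn (s : Set ℝ) (f : ℝ → Measure (ℝ × ℝ × ℝ)) : Prop where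
  admissible : ∀ t ∈ s, E.IsAdmissible (f t)
  integrable : ∀ g : ℝ × ℝ × ℝ → ℝ, ContDiff ℝ ∞ g → HasCompactSupport g → ∀ t ∈ s,
    Integrable (E.transport (f t) g) (f t)
  hasDerivWithinAt : ∀ g : ℝ × ℝ × ℝ → ℝ, ContDiff ℝ ∞ g → HasCompactSupport g → ∀ t ∈ s,
    HasDerivWithinAt (fun τ => ∫ z, g z ∂(f τ)) (∫ z, E.transport (f t) g z ∂(f t)) s t

/-- **Stationary states**: admissible `μ` with `∫ X_μ g dμ = 0` for every smooth compactly supported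
`g` (weak form of `p ∂_q f₀ - ∂_q[U + W_{f₀}] ∂_p f₀ = 0`).
[cite: BachelardEtAl2011, §III (stationary solutions)] -/
structure IsStationary (μ : Measure (ℝ × ℝ × ℝ)) : Prop where
  admissible : E.IsAdmissible μ
  integrable : ∀ g : ℝ × ℝ × ℝ → ℝ, ContDiff ℝ ∞ g → HasCompactSupport g →
    Integrable (E.transport μ g) μ
  integral_eq_zero : ∀ g : ℝ × ℝ × ℝ → ℝ, ContDiff ℝ ∞ g → HasCompactSupport g →
    ∫ z, E.transport μ g z ∂μ = 0

/-- **Energy-function (Jeans / energy–Casimir) states**: `μ` has Lebesgue density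
`F(u, h_μ(u, q, p))`, a function of the label and of the SELF-CONSISTENT one-body energy (a fixed-point
condition through `W_μ`). Lemma target (not proved here): every sufficiently regular such state is
stationary, `E.IsEnergyFunctionState F μ → … → E.IsStationary μ` (`{h_μ, F(u, h_μ)} = 0` and an
integration by parts in `(q, p)`); the thermal state below is the member `F(u, e) = 1_{[0,L]}(u) e^{-e/T}/Z(u)`.
[cite: CampaEtAl2014, §9.1 p. 188 (any f₀ = F(e) with self-consistent field is stationary)] -/
def IsEnergyFunctionState (F : ℝ → ℝ → ℝ) (μ : Measure (ℝ × ℝ × ℝ)) : Prop :=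
  μ = volume.withDensity (fun z => ENNReal.ofReal (F z.1 (E.energy μ z)))

/-! ### The thermal (Hartree) state -/

/-- The self-consistent Gibbs weight `e^{-h_μ(u,q,p)/T}`. [folklore] -/
def gibbsWeight (T : ℝ) (μ : Measure (ℝ × ℝ × ℝ)) (z : ℝ × ℝ × ℝ) : ℝ :=
  Real.exp (-E.energy μ z / T)

/-- The one-body partition function at label `u`: `Z_μ(u) = ∬ e^{-h_μ(u,q,p)/T} dq dp`. [folklore] -/
def partitionFunction (T : ℝ) (μ : Measure (ℝ × ℝ × ℝ)) (u : ℝ) : ℝ :=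
  ∫ x : ℝ × ℝ, E.gibbsWeight T μ (u, x)

/-- The thermal density `1_{[0,L]}(u) e^{-h_μ(u,q,p)/T} / Z_μ(u)` (unit mass per label). [folklore] -/
def thermalDensity (T : ℝ) (μ : Measure (ℝ × ℝ × ℝ)) (z : ℝ × ℝ × ℝ) : ℝ :=
  (Icc 0 E.L).indicator (fun _ => (1 : ℝ)) z.1 * (E.gibbsWeight T μ z / E.partitionFunction T μ z.1)

/-- **The thermal (Hartree, self-consistent Maxwell–Boltzmann) state at temperature `T`**: an
admissible `μ` whose Gibbs weights are integrable label by label and which has Lebesgue density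
`1_{[0,L]}(u) e^{-h_μ(u,q,p)/T} / Z_μ(u)` — a fixed-point condition, since `h_μ` contains the mean
field `W_μ` of `μ` itself (for `V(r) = r²/2` it reduces to the scalar self-consistency of
`m(u) = ∫ φ(u - u′) q′ dμ`, as for the magnetisation of the HMF model). The `F(e) = e^{-e/T}` member
of the self-consistent energy-function states `F(u, h_μ)`, all stationary.
[cite: CampaEtAl2014, §9.1 p. 188 (self-consistent F(e) states; Boltzmann–Gibbs equilibrium)] -/
structure IsThermalState (T : ℝ) (μ : Measure (ℝ × ℝ × ℝ)) : Prop where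
  admissible : E.IsAdmissible μ
  integrable_gibbsWeight : ∀ u ∈ Icc 0 E.L, Integrable (fun x : ℝ × ℝ => E.gibbsWeight T μ (u, x))
  eq_withDensity : μ = volume.withDensity (fun z => ENNReal.ofReal (E.thermalDensity T μ z))

/-! ### The linearised equation around a stationary state -/

/-- The mean field of a (signed) perturbation density `ρ(u, q, p)` w.r.t. `du dq dp`:
`W_ρ(u, q) = ∫ φ(u - u′) V(q - q′) ρ(z′) dz′`. [cite: CampaEtAl2014, §8.2 eq. (8.14)–(8.15)] -/
def meanFieldDensity (ρ : ℝ × ℝ × ℝ → ℝ) (u q : ℝ) : ℝ :=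
  ∫ z, E.φ (u - z.1) * E.V (q - z.2.1) * ρ z

/-- The linearised force `-∂_q W_ρ(u, ·)(q)` of a perturbation density `ρ`. [folklore] -/
def linearisedForce (ρ : ℝ × ℝ × ℝ → ℝ) (u q : ℝ) : ℝ :=
  -deriv (fun x => E.meanFieldDensity ρ u x) q

/-- **Weak solutions of the lattice Vlasov equation linearised around a stationary state `μ₀`**, for
a perturbation density `g_t(u, q, p)` (w.r.t. Lebesgue measure) on a time set `s`:
`∂_t g + p ∂_q g - ∂_q[U + W_{μ₀}] ∂_p g - ∂_q W_{g} ∂_p f₀ = 0`, i.e. for all `ψ ∈ C_c^∞` and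
`t ∈ s`, `d/dt ∫ ψ g_t dz = ∫ (X_{μ₀} ψ) g_t dz + ∫ (-∂_q W_{g_t})(u,q) ∂_p ψ dμ₀` (the last term is
`∫ ψ (-∂_q W_g) ∂_p f₀` after integrating by parts in `p`), with the tested integrands integrable.
[cite: CampaEtAl2014, §8.2 eq. (8.20) (linearised Vlasov equation)] -/
structure IsLinearisedSolutionOn (s : Set ℝ) (μ₀ : Measure (ℝ × ℝ × ℝ))
    (g : ℝ → ℝ × ℝ × ℝ → ℝ) : Prop where
  locallyIntegrable : ∀ t ∈ s, LocallyIntegrable (g t)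
  integrable_interaction : ∀ t ∈ s, ∀ u q : ℝ,
    Integrable (fun z : ℝ × ℝ × ℝ => E.φ (u - z.1) * E.V (q - z.2.1) * g t z)
  integrable_transport : ∀ ψ : ℝ × ℝ × ℝ → ℝ, ContDiff ℝ ∞ ψ → HasCompactSupport ψ → ∀ t ∈ s,
    Integrable (fun z => E.transport μ₀ ψ z * g t z)
  integrable_response : ∀ ψ : ℝ × ℝ × ℝ → ℝ, ContDiff ℝ ∞ ψ → HasCompactSupport ψ → ∀ t ∈ s,
    Integrable (fun z => E.linearisedForce (g t) z.1 z.2.1 * partialP ψ z) μ₀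
  hasDerivWithinAt : ∀ ψ : ℝ × ℝ × ℝ → ℝ, ContDiff ℝ ∞ ψ → HasCompactSupport ψ → ∀ t ∈ s,
    HasDerivWithinAt (fun τ => ∫ z, ψ z * g τ z)
      ((∫ z, E.transport μ₀ ψ z * g t z) +
        ∫ z, E.linearisedForce (g t) z.1 z.2.1 * partialP ψ z ∂μ₀) s t

/-! ### Empirical measures of the chain -/

/-- The empirical measure `R⁻¹ Σ_i δ_{(i/R, q_i, p_i)}` of a configuration of the `N`-site chain at
range `R` (labels `u_i = i/R`; total mass `N/R = L`). [cite: CampaEtAl2014, §8.1 eq. (8.3)] -/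
def empiricalMeasure (R : ℕ) {N : ℕ} (x : HeatConduction.PhaseSpace N) : Measure (ℝ × ℝ × ℝ) :=
  ∑ i : Fin N, (R : ℝ≥0∞)⁻¹ • Measure.dirac (((i : ℝ) / R, x.1 i, x.2 i) : ℝ × ℝ × ℝ)

/-! ### API -/

variable {E}

/-- `∂_p h_μ = p`. [folklore] -/
theorem partialP_energy (μ : Measure (ℝ × ℝ × ℝ)) (z : ℝ × ℝ × ℝ) :
    partialP (E.energy μ) z = z.2.2 := by
  unfold partialP energy
  have hd : HasDerivAt (fun t : ℝ => t ^ 2 / 2) z.2.2 z.2.2 := by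
    simpa using (hasDerivAt_pow 2 z.2.2).div_const 2
  exact ((hd.add_const (E.U z.2.1)).add_const (E.meanField μ z.1 z.2.1)).deriv

/-- `∂_q h_μ = ∂_q (U + W_μ(u, ·))`. [folklore] -/
theorem partialQ_energy (μ : Measure (ℝ × ℝ × ℝ)) (z : ℝ × ℝ × ℝ) :
    partialQ (E.energy μ) z = deriv (fun x => E.U x + E.meanField μ z.1 x) z.2.1 := by
  unfold partialQ energy
  simp only [add_assoc]
  exact deriv_const_add _

/-- The transport operator is the bracket with the self-consistent energy: `X_μ g = {h_μ, g}`.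
[cite: BachelardEtAl2011, §III (h_x generates the test-particle motion)] -/
theorem transport_eq_bracket (μ : Measure (ℝ × ℝ × ℝ)) (g : ℝ × ℝ × ℝ → ℝ) (z : ℝ × ℝ × ℝ) :
    E.transport μ g z = bracket (E.energy μ) g z := by
  simp only [transport, bracket, force, partialP_energy, partialQ_energy]
  ring

/-- `bracket f f = 0`; in particular `X_μ h_μ = 0` (the one-body energy is conserved along
characteristics). [folklore] -/
theorem bracket_self (f : ℝ × ℝ × ℝ → ℝ) (z : ℝ × ℝ × ℝ) : bracket f f z = 0 := by
  unfold bracket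
  ring

/-- An admissible state has total mass `L`. [folklore] -/
theorem IsAdmissible.measure_univ {μ : Measure (ℝ × ℝ × ℝ)} (h : E.IsAdmissible μ) :
    μ univ = ENNReal.ofReal E.L := by
  have h1 := congrArg (fun ν : Measure ℝ => ν univ) h.map_fst
  simp only [Measure.map_apply measurable_fst MeasurableSet.univ, preimage_univ, labelMeasure,
    Measure.restrict_apply MeasurableSet.univ, univ_inter, Real.volume_Icc, sub_zero] at h1
  exact h1

/-- An admissible state is a finite measure. [folklore] -/
theorem IsAdmissible.isFiniteMeasure {μ : Measure (ℝ × ℝ × ℝ)} (h : E.IsAdmissible μ) :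
    IsFiniteMeasure μ :=
  ⟨by rw [h.measure_univ]; exact ENNReal.ofReal_lt_top⟩

/-- A thermal state is the energy-function state `F(u, e) = 1_{[0,L]}(u) e^{-e/T} / Z_μ(u)`. [folklore] -/
theorem IsThermalState.isEnergyFunctionState {T : ℝ} {μ : Measure (ℝ × ℝ × ℝ)}
    (h : E.IsThermalState T μ) :
    E.IsEnergyFunctionState
      (fun u e => (Icc 0 E.L).indicator (fun _ => (1 : ℝ)) u *
        (Real.exp (-e / T) / E.partitionFunction T μ u)) μ :=
  h.eq_withDensity

/-- A stationary state, as a constant curve, is a weak solution on every time set. [folklore] -/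
theorem IsStationary.isWeakSolutionOn {μ : Measure (ℝ × ℝ × ℝ)} (h : E.IsStationary μ) (s : Set ℝ) :
    E.IsWeakSolutionOn s (fun _ => μ) where
  admissible := fun _ _ => h.admissible
  integrable := fun g hg hc _ _ => h.integrable g hg hc
  hasDerivWithinAt := fun g hg hc t _ => by
    rw [h.integral_eq_zero g hg hc]
    exact hasDerivWithinAt_const t s _

/-- Stationary states are exactly the constant weak solutions on `ℝ`. [folklore] -/
theorem isStationary_iff_isWeakSolutionOn_univ {μ : Measure (ℝ × ℝ × ℝ)} :
    E.IsStationary μ ↔ E.IsWeakSolutionOn univ (fun _ => μ) := by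
  refine ⟨fun h => h.isWeakSolutionOn univ, fun h => ⟨h.admissible 0 (mem_univ _),
    fun g hg hc => h.integrable g hg hc 0 (mem_univ _), fun g hg hc => ?_⟩⟩
  have h1 := (h.hasDerivWithinAt g hg hc 0 (mem_univ _)).hasDerivAt univ_mem
  exact h1.unique (hasDerivAt_const _ _)

/-- The mean field of the zero perturbation vanishes. [folklore] -/
@[simp] theorem meanFieldDensity_zero (u q : ℝ) : E.meanFieldDensity (fun _ => 0) u q = 0 := by
  simp [meanFieldDensity]

/-- The linearised force of the zero perturbation vanishes. [folklore] -/
@[simp] theorem linearisedForce_zero (u q : ℝ) : E.linearisedForce (fun _ => 0) u q = 0 := by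
  simp [linearisedForce]

/-- The zero perturbation solves the linearised equation (around any state, on any time set).
[folklore] -/
theorem isLinearisedSolutionOn_zero (s : Set ℝ) (μ₀ : Measure (ℝ × ℝ × ℝ)) :
    E.IsLinearisedSolutionOn s μ₀ (fun _ _ => 0) where
  locallyIntegrable := fun _ _ => (integrable_zero _ _ _).locallyIntegrable
  integrable_interaction := fun _ _ _ _ => by simp
  integrable_transport := fun _ _ _ _ _ => by simp
  integrable_response := fun _ _ _ _ _ => by simp
  hasDerivWithinAt := fun _ _ _ t _ => by simpa using hasDerivWithinAt_const t s (0 : ℝ)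

/-- **Calibration with the Kac chain**: the mean field of the empirical measure of a configuration
is the Kac pair sum `R⁻¹ Σ_j φ(u - j/R) V(q - q_j)`; at `u = i/R`, `q = q_i` this is the interaction
energy `Σ_j R⁻¹ φ((i - j)/R) V(q_i - q_j)` of site `i` in the Kac Hamiltonian (`KacOscillatorChain.lean`;
`φ` even, up to the self term `j = i`).
[cite: CampaEtAl2014, §8.1 eq. (8.8) (the Klimontovich mean field)] -/
theorem meanField_empiricalMeasure {R : ℕ} (hR : R ≠ 0) {N : ℕ} (x : HeatConduction.PhaseSpace N)
    (u q : ℝ) :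
    E.meanField (empiricalMeasure R x) u q =
      ∑ j : Fin N, (R : ℝ)⁻¹ * (E.φ (u - j / R) * E.V (q - x.1 j)) := by
  have hR' : (R : ℝ≥0∞)⁻¹ ≠ ⊤ := ENNReal.inv_ne_top.mpr (Nat.cast_ne_zero.mpr hR)
  unfold meanField empiricalMeasure
  rw [integral_finsetSum_measure]
  · refine Finset.sum_congr rfl fun j _ => ?_
    rw [integral_smul_measure, integral_dirac]
    simp [ENNReal.toReal_inv]
  · intro j _
    refine Integrable.smul_measure ?_ hR'
    exact (integrable_const _).congr (ae_eq_dirac _).symm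

/-- The empirical measure has total mass `N / R` (`= L` for `N = L R` sites). [folklore] -/
theorem empiricalMeasure_univ (R : ℕ) {N : ℕ} (x : HeatConduction.PhaseSpace N) :
    empiricalMeasure R x univ = N * (R : ℝ≥0∞)⁻¹ := by
  simp [empiricalMeasure]

end LatticeVlasovEquation


end Literature.MathematicalPhysics.KineticTheory
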